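import Literature.AlgebraicGeometry.Frobenioids.PerfFactorialCoprime
import HarnessLib

/-!
# Frobenioids I, Definition 2.4 (i): `𝔭`-parts and `𝔭`-free parts in a perfect perf-factorial monoid
# (the "primary factorizations" used in the proof of Theorem 4.9, p. 90)

Mochizuki, *The geometry of Frobenioids I: the general theory*, Kyushu J. Math. **62** (2008)
293–400, §2 Definition 2.4 (i)(c)(d) (kurims pp. 47–48), as used in the proof of Theorem 4.9
(p. 90 ll. 5–27: "β is primary with zero divisor that maps via `Φ(β)⁻¹` to an element of `𝔭`, and
`𝔭` is not contained in the support of `(Φ(ζ))⁻¹(Div(γ))`") [cite: MochizukiFrdI2008, Def. 2.4(i) p.47]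
[cite: MochizukiFrdI2008, Thm. 4.9 p.90].

PROOF-ONLY companion of `PerfFactorialSplitting.lean` / `PerfFactorialSupports.lean` (seat abc-iut-w5-d021,
D-0068 sub-DAG S5, row `FrdI:Thm4.9/T49-L07`, existence half): for a PERFECT perf-factorial monoid `M`
(in Thm. 4.9, `M = Φ(A)`, perfect by Prop. 1.10 (iii)) and a prime `𝔭 ∈ Prime(M)`, everything is
stated inside `M` itself, with "`𝔭 ∉ Supp(x)`" rendered as "no element of the subset `𝔭 ⊆ M` divides
`x`" and "`Supp(x) ⊆ {𝔭}`" as "`x = 0` or `x ∈ 𝔭`":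
* `exists_primePart_split` — every `x` is `x₁ + x₂` with `x₁ ∈ 𝔭 ∪ {0}` and `𝔭 ∉ Supp(x₂)`
  (transport of `IsPerfFactorial.exists_split` along `M ≅ M^pf`);
* `primePart_unique` — such a splitting is unique (coordinates in `M^pf_factor`);
* `exists_primePart_of_mul_eq_mul` — the comparison used on p. 90: from `x₁ + b = x₂ + a` with
  `𝔭 ∈ Supp(a)`, `𝔭 ∉ Supp(b)` one gets `x₁ = m + p + r`, `x₂ = m + w` with `p ∈ 𝔭` and
  `𝔭 ∉ Supp(r)`, `𝔭 ∉ Supp(w)`;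
* `forall_common_dvd_eq_one_of_mem_carrier` — an element of `𝔭` and a `𝔭`-free element have no
  non-trivial common lower bound (the co-primarity input of Prop. 4.1 (iii)).
Multiplicative notation as in `Monoids.lean`. No new definitions.
-/

namespace Literature.AlgebraicGeometry.Frobenioids

open Function

universe u

variable {M : Type u} [CommMonoid M]

/-! ### Elements of `𝔭` versus `𝔭`-free elements -/

/-- A non-trivial divisor of an element of `𝔭` lies in `𝔭` (local copy of the tree's
`Primes.mem_carrier_of_dvd`, `PrimesEquivPreStep.lean`, not imported to keep this file on the §2 monoid
layer). [cite: MochizukiFrdI2008, §0 p.12] -/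
private theorem mem_carrier_of_dvd_aux (𝔭 : Primes M) {p x : M} (hp : p ∈ 𝔭.carrier) (hx : x ≠ 1)
    (hxp : x ∣ p) : x ∈ 𝔭.carrier :=
  𝔭.mem_carrier_of_precsim hp hx (Precsim.of_dvd hxp)

/-- An element of `𝔭` and a `𝔭`-free element (no element of `𝔭` divides it) have no non-trivial
common divisor — the "disjoint supports" input of Prop. 4.1 (iii) in the form of
`IsPerfFactorial.forall_common_dvd_eq_one_iff_disjoint_supp`. [cite: MochizukiFrdI2008, Prop. 4.1 (iii) p.76] -/
theorem forall_common_dvd_eq_one_of_mem_carrier (𝔭 : Primes M) {p r : M} (hp : p ∈ 𝔭.carrier)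
    (hr : ∀ q ∈ 𝔭.carrier, ¬ q ∣ r) : ∀ x : M, x ∣ r → x ∣ p → x = 1 := by
  intro x hxr hxp
  by_contra hx
  exact hr x (mem_carrier_of_dvd_aux 𝔭 hp hx hxp) hxr

/-- Symmetric form: a `𝔭`-free element and an element of `𝔭` have no non-trivial common divisor.
[cite: MochizukiFrdI2008, Prop. 4.1 (iii) p.76] -/
theorem forall_common_dvd_eq_one_of_mem_carrier' (𝔭 : Primes M) {p r : M} (hp : p ∈ 𝔭.carrier)
    (hr : ∀ q ∈ 𝔭.carrier, ¬ q ∣ r) : ∀ x : M, x ∣ p → x ∣ r → x = 1 :=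
  fun x hxp hxr => forall_common_dvd_eq_one_of_mem_carrier 𝔭 hp hr x hxr hxp

/-- A divisor of a `𝔭`-free element is `𝔭`-free. [cite: MochizukiFrdI2008, Def. 2.4(i) p.47] -/
theorem primeFree_of_dvd (𝔭 : Primes M) {x y : M} (hy : ∀ q ∈ 𝔭.carrier, ¬ q ∣ y) (hxy : x ∣ y) :
    ∀ q ∈ 𝔭.carrier, ¬ q ∣ x :=
  fun q hq hqx => hy q hq (hqx.trans hxy)

/-- The product of two elements of `𝔭 ∪ {0}` lies in `𝔭 ∪ {0}` (sharp `M`).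
[cite: MochizukiFrdI2008, §0 p.12] -/
theorem mul_mem_carrier_or_eq_one (hM : IsSharp M) (𝔭 : Primes M) {x y : M}
    (hx : x = 1 ∨ x ∈ 𝔭.carrier) (hy : y = 1 ∨ y ∈ 𝔭.carrier) : x * y = 1 ∨ x * y ∈ 𝔭.carrier := by
  rcases hx with rfl | hx
  · rw [one_mul]; exact hy
  rcases hy with rfl | hy
  · rw [mul_one]; exact Or.inr hx
  refine Or.inr (𝔭.mem_carrier_of_precsim hx ?_ ?_)
  · intro h
    exact hx.1.1 (hM.1 _ (IsUnit.of_mul_eq_one _ h))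
  · obtain ⟨n, hn, c, hc⟩ := 𝔭.precsim_of_mem_carrier hy hx
    refine ⟨n + 1, Nat.succ_pos _, c, ?_⟩
    rw [pow_succ, hc]
    simp only [mul_comm, mul_left_comm]

section Perfect

/-! ### The prime of `M^pf` over a prime of `M` (for `M` sharp) -/

/-- For `p ∈ 𝔭` (so `p` primary) the image `of p ∈ M^pf` is primary; its class is "the prime of
`M^pf` over `𝔭`". Every `q ∈ 𝔭` maps into that class. [cite: MochizukiFrdI2008, §0 p.12] -/
theorem of_mem_carrier_mk (hM : IsSharp M) (𝔭 : Primes M) {p₀ : M} (hp₀ : p₀ ∈ 𝔭.carrier)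
    (hprim : IsPrimary (Perfection.of M p₀)) {q : M} (hq : q ∈ 𝔭.carrier) :
    Perfection.of M q ∈ Primes.carrier (Quotient.mk (primarySetoid (Perfection M)) ⟨_, hprim⟩) := by
  have hq' : IsPrimary (Perfection.of M q) := (Perfection.isPrimary_of_iff hM).mpr hq.1
  refine ⟨hq', Quotient.sound (s := primarySetoid (Perfection M)) ?_⟩
  exact Precsim.map (Perfection.of M) (𝔭.precsim_of_mem_carrier hq hp₀)

/-- Conversely, an element of `M` whose image lies in the prime of `M^pf` over `𝔭` lies in `𝔭`.
[cite: MochizukiFrdI2008, §0 p.12] -/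
theorem mem_carrier_of_of_mem_carrier_mk (hM : IsSharp M) (𝔭 : Primes M) {p₀ : M}
    (hp₀ : p₀ ∈ 𝔭.carrier) (hprim : IsPrimary (Perfection.of M p₀)) {X : M}
    (hX : Perfection.of M X ∈ Primes.carrier (Quotient.mk (primarySetoid (Perfection M)) ⟨_, hprim⟩)) :
    X ∈ 𝔭.carrier := by
  have hXp : IsPrimary X := (Perfection.isPrimary_of_iff hM).mp hX.1
  have h1 : Perfection.of M X ≼ Perfection.of M p₀ :=
    Primes.precsim_of_mem_carrier _ hX (mem_carrier_mk_of_isPrimary hprim)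
  exact 𝔭.mem_carrier_of_precsim hp₀ hXp.1 (Perfection.of_precsim_of_iff.mp h1)

/-! ### Splitting off the `𝔭`-part -/

/-- **The `𝔭`-part and the `𝔭`-free part** (Def. 2.4 (i)(c)(d), "the primary factorizations"): in a
perfect perf-factorial monoid every `x` is `x₁ + x₂` with `x₁ ∈ 𝔭 ∪ {0}` and no element of `𝔭`
dividing `x₂`. [cite: MochizukiFrdI2008, Def. 2.4(i) p.47] -/
theorem IsPerfFactorial.exists_primePart_split (h : IsPerfFactorial M) (hperf : IsPerfect M)
    (𝔭 : Primes M) (x : M) :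
    ∃ x₁ x₂ : M, x₁ * x₂ = x ∧ (x₁ = 1 ∨ x₁ ∈ 𝔭.carrier) ∧ ∀ q ∈ 𝔭.carrier, ¬ q ∣ x₂ := by
  classical
  have hM : IsSharp M := h.isDivisorial.isSharp
  have hbij := isPerfect_iff_bijective_of.mp hperf
  obtain ⟨⟨p₀, hp₀'⟩, hp₀⟩ := Quotient.exists_rep 𝔭
  have hp₀c : p₀ ∈ 𝔭.carrier := ⟨hp₀', hp₀⟩
  have hprim : IsPrimary (Perfection.of M p₀) := (Perfection.isPrimary_of_iff hM).mpr hp₀'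
  let 𝔮 : Primes (Perfection M) := Quotient.mk (primarySetoid (Perfection M)) ⟨_, hprim⟩
  obtain ⟨y₁, y₂, x₁', hy, hy₁, hy₂⟩ := h.exists_split (Perfection.of M x) 𝔮
  obtain ⟨X₁, rfl⟩ := hbij.2 y₁
  obtain ⟨X₂, rfl⟩ := hbij.2 y₂
  refine ⟨X₁, X₂, hbij.1 (by rw [map_mul, hy]), ?_, ?_⟩
  · by_cases h1 : Perfection.of M X₁ = 1
    · exact Or.inl (hbij.1 (by rw [h1, map_one]))
    · exact Or.inr (mem_carrier_of_of_mem_carrier_mk hM 𝔭 hp₀c hprim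
        (h.mem_carrier_of_factorMap_eq_mulSingle x₁' hy₁ h1))
  · intro q hq hqX
    exact h.not_dvd_of_factorMap_apply_eq_one (of_mem_carrier_mk hM 𝔭 hp₀c hprim hq) hy₂
      (map_dvd (Perfection.of M) hqX)

/-- The `𝔮`-coordinate of a `𝔭`-free element vanishes, `𝔮` the prime of `M^pf` over `𝔭`.
[cite: MochizukiFrdI2008, Def. 2.4(i) p.47] -/
theorem IsPerfFactorial.factorMap_of_apply_eq_one_of_primeFree (h : IsPerfFactorial M)
    (hperf : IsPerfect M) (𝔭 : Primes M) {p₀ : M} (hp₀ : p₀ ∈ 𝔭.carrier)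
    (hprim : IsPrimary (Perfection.of M p₀)) {x : M} (hx : ∀ q ∈ 𝔭.carrier, ¬ q ∣ x) :
    factorMap M (Perfection.of M x) (Quotient.mk (primarySetoid (Perfection M)) ⟨_, hprim⟩) = 1 := by
  classical
  have hM : IsSharp M := h.isDivisorial.isSharp
  have hbij := isPerfect_iff_bijective_of.mp hperf
  set 𝔮 : Primes (Perfection M) := Quotient.mk (primarySetoid (Perfection M)) ⟨_, hprim⟩ with h𝔮
  obtain ⟨y₁, y₂, x₁', hy, hy₁, hy₂⟩ := h.exists_split (Perfection.of M x) 𝔮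
  have hy₁1 : y₁ = 1 := by
    by_contra h1
    obtain ⟨X₁, rfl⟩ := hbij.2 y₁
    have hX₁ : X₁ ∈ 𝔭.carrier := mem_carrier_of_of_mem_carrier_mk hM 𝔭 hp₀ hprim
      (h.mem_carrier_of_factorMap_eq_mulSingle x₁' hy₁ h1)
    obtain ⟨X₂, rfl⟩ := hbij.2 y₂
    exact hx X₁ hX₁ ⟨X₂, hbij.1 (by rw [map_mul, hy])⟩
  rw [h.factorMap_apply_of_split_same hy hy₂, hy₁1, h.factorMap_one]
  rfl

/-- The coordinates of an element of `𝔭 ∪ {0}` vanish off the prime of `M^pf` over `𝔭`.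
[cite: MochizukiFrdI2008, Def. 2.4(i) p.47] -/
theorem IsPerfFactorial.factorMap_of_apply_eq_one_of_ne (h : IsPerfFactorial M) (𝔭 : Primes M)
    {p₀ : M} (hp₀ : p₀ ∈ 𝔭.carrier) (hprim : IsPrimary (Perfection.of M p₀)) {x : M}
    (hx : x = 1 ∨ x ∈ 𝔭.carrier) {𝔮' : Primes (Perfection M)}
    (hne : 𝔮' ≠ Quotient.mk (primarySetoid (Perfection M)) ⟨_, hprim⟩) :
    factorMap M (Perfection.of M x) 𝔮' = 1 := by
  have hM : IsSharp M := h.isDivisorial.isSharp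
  rcases hx with rfl | hx
  · rw [map_one, h.factorMap_one]; rfl
  · exact factorMap_apply_of_ne M (of_mem_carrier_mk hM 𝔭 hp₀ hprim hx) hne

/-- **Uniqueness of the splitting**: if `x₁ + x₂ = x₁' + x₂'` with `x₁, x₁' ∈ 𝔭 ∪ {0}` and
`x₂, x₂'` `𝔭`-free, then `x₁ = x₁'` and `x₂ = x₂'` (compare coordinates in `M^pf_factor`,
Def. 2.4 (i)(c)). [cite: MochizukiFrdI2008, Def. 2.4(i) p.47] -/
theorem IsPerfFactorial.primePart_unique (h : IsPerfFactorial M) (hperf : IsPerfect M)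
    (𝔭 : Primes M) {x₁ x₂ x₁' x₂' : M} (hx₁ : x₁ = 1 ∨ x₁ ∈ 𝔭.carrier)
    (hx₁' : x₁' = 1 ∨ x₁' ∈ 𝔭.carrier) (hx₂ : ∀ q ∈ 𝔭.carrier, ¬ q ∣ x₂)
    (hx₂' : ∀ q ∈ 𝔭.carrier, ¬ q ∣ x₂') (e : x₁ * x₂ = x₁' * x₂') : x₁ = x₁' ∧ x₂ = x₂' := by
  classical
  have hM : IsSharp M := h.isDivisorial.isSharp
  have hbij := isPerfect_iff_bijective_of.mp hperf
  haveI : IsCancelMul M := isIntegral_iff_isCancelMul.mp h.isDivisorial.isPreDivisorial.isIntegral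
  obtain ⟨⟨p₀, hp₀'⟩, hp₀⟩ := Quotient.exists_rep 𝔭
  have hp₀c : p₀ ∈ 𝔭.carrier := ⟨hp₀', hp₀⟩
  have hprim : IsPrimary (Perfection.of M p₀) := (Perfection.isPrimary_of_iff hM).mpr hp₀'
  set 𝔮 : Primes (Perfection M) := Quotient.mk (primarySetoid (Perfection M)) ⟨_, hprim⟩ with h𝔮
  have eF : factorMap M (Perfection.of M x₁) * factorMap M (Perfection.of M x₂) =
      factorMap M (Perfection.of M x₁') * factorMap M (Perfection.of M x₂') := by
    rw [← h.factorMap_mul, ← h.factorMap_mul, ← map_mul, ← map_mul, e]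
  have h1 : x₁ = x₁' := by
    apply hbij.1
    apply h.factorMap_injective
    funext 𝔮''
    by_cases hq : 𝔮'' = 𝔮
    · have e𝔮 := congrFun eF 𝔮''
      rw [Pi.mul_apply, Pi.mul_apply, hq,
        h.factorMap_of_apply_eq_one_of_primeFree hperf 𝔭 hp₀c hprim hx₂,
        h.factorMap_of_apply_eq_one_of_primeFree hperf 𝔭 hp₀c hprim hx₂', mul_one, mul_one] at e𝔮
      rw [hq]
      exact e𝔮
    · rw [h.factorMap_of_apply_eq_one_of_ne 𝔭 hp₀c hprim hx₁ hq,
        h.factorMap_of_apply_eq_one_of_ne 𝔭 hp₀c hprim hx₁' hq]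
  refine ⟨h1, ?_⟩
  rw [h1] at e
  exact mul_left_cancel e

/-- `𝔭`-free elements are closed under products (coordinates at the prime over `𝔭` multiply).
[cite: MochizukiFrdI2008, Def. 2.4(i) p.47] -/
theorem IsPerfFactorial.primeFree_mul (h : IsPerfFactorial M) (hperf : IsPerfect M) (𝔭 : Primes M)
    {x y : M} (hx : ∀ q ∈ 𝔭.carrier, ¬ q ∣ x) (hy : ∀ q ∈ 𝔭.carrier, ¬ q ∣ y) :
    ∀ q ∈ 𝔭.carrier, ¬ q ∣ x * y := by
  classical
  have hM : IsSharp M := h.isDivisorial.isSharp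
  obtain ⟨⟨p₀, hp₀'⟩, hp₀⟩ := Quotient.exists_rep 𝔭
  have hp₀c : p₀ ∈ 𝔭.carrier := ⟨hp₀', hp₀⟩
  have hprim : IsPrimary (Perfection.of M p₀) := (Perfection.isPrimary_of_iff hM).mpr hp₀'
  intro q hq hqxy
  have hxy : factorMap M (Perfection.of M (x * y))
      (Quotient.mk (primarySetoid (Perfection M)) ⟨_, hprim⟩) = 1 := by
    rw [map_mul, h.factorMap_mul, Pi.mul_apply,
      h.factorMap_of_apply_eq_one_of_primeFree hperf 𝔭 hp₀c hprim hx,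
      h.factorMap_of_apply_eq_one_of_primeFree hperf 𝔭 hp₀c hprim hy, mul_one]
  exact h.not_dvd_of_factorMap_apply_eq_one (of_mem_carrier_mk hM 𝔭 hp₀c hprim hq) hxy
    (map_dvd (Perfection.of M) hqxy)

/-! ### The comparison used in the proof of Theorem 4.9 -/

/-- **[FrdI] proof of Thm. 4.9, p. 90 ll. 10–17, in the language of monoids**: in a perfect
perf-factorial monoid, if `x₁ + b = x₂ + a` with `𝔭 ∈ Supp(a)` (some element of `𝔭` divides `a`)
and `𝔭 ∉ Supp(b)`, then, `m` denoting the `𝔭`-part of `x₂`, one has `x₁ = m + p + r` and `x₂ = m + w`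
with `p ∈ 𝔭` ("β is primary with zero divisor … an element of `𝔭`") and `r`, `w` `𝔭`-free ("`𝔭` is
not contained in the support of `(Φ(ζ))⁻¹(Div(γ))`"). [cite: MochizukiFrdI2008, Thm. 4.9 p.90] -/
theorem IsPerfFactorial.exists_primePart_of_mul_eq_mul (h : IsPerfFactorial M) (hperf : IsPerfect M)
    (𝔭 : Primes M) {x₁ x₂ a b : M} (e : x₁ * b = x₂ * a) (ha : ∃ q ∈ 𝔭.carrier, q ∣ a)
    (hb : ∀ q ∈ 𝔭.carrier, ¬ q ∣ b) :
    ∃ m p r w : M, x₁ = m * (p * r) ∧ x₂ = m * w ∧ p ∈ 𝔭.carrier ∧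
      (∀ q ∈ 𝔭.carrier, ¬ q ∣ r) ∧ (∀ q ∈ 𝔭.carrier, ¬ q ∣ w) := by
  have hM : IsSharp M := h.isDivisorial.isSharp
  obtain ⟨m, w, hmw, hm, hw⟩ := h.exists_primePart_split hperf 𝔭 x₂
  obtain ⟨n, u, hnu, hn, hu⟩ := h.exists_primePart_split hperf 𝔭 x₁
  obtain ⟨a₁, a₂, ha₁₂, ha₁, ha₂⟩ := h.exists_primePart_split hperf 𝔭 a
  -- compare the two splittings of `x₁ + b = x₂ + a`
  have e' : n * (u * b) = (m * a₁) * (w * a₂) := by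
    calc n * (u * b) = (n * u) * b := by rw [mul_assoc]
      _ = x₂ * a := by rw [hnu, e]
      _ = (m * w) * (a₁ * a₂) := by rw [hmw, ha₁₂]
      _ = (m * a₁) * (w * a₂) := by simp only [mul_comm, mul_left_comm]
  obtain ⟨hn', hub⟩ := h.primePart_unique hperf 𝔭 hn (mul_mem_carrier_or_eq_one hM 𝔭 hm ha₁)
    (h.primeFree_mul hperf 𝔭 hu hb) (h.primeFree_mul hperf 𝔭 hw ha₂) e'
  have ha₁c : a₁ ∈ 𝔭.carrier := by
    rcases ha₁ with rfl | ha₁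
    · exfalso
      obtain ⟨q, hq, hqa⟩ := ha
      rw [one_mul] at ha₁₂
      exact ha₂ q hq (ha₁₂.symm ▸ hqa)
    · exact ha₁
  refine ⟨m, a₁, u, w, ?_, hmw.symm, ha₁c, hu, hw⟩
  rw [← hnu, hn', mul_assoc]

end Perfect

end Literature.AlgebraicGeometry.Frobenioids
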